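import Mathlib.Algebra.BigOperators.Ring.Finset
import Literature.Computability.MetaComplexity.ResLinExtensible
import HarnessLib

/-!
# The ordering principle `Ordering_n`: clauses, proper assignments and linear orders (GOR 2024, §3.1.2)

The CNF `Ordering_n` (`orderingCNF n`) says that a linear order on `[n]` has no minimum
[Gryaznov–Ovcharov–Riazanov 2024, §3.1.2; Gryaznov 2019, §3.2; Krishnamurthy 1985 / Stålmarck 1996
for resolution]: variables `x_{ij}` (`ordVar n i j = i·n + j`, `i ≠ j < n`, "`i ≺ j`"), clauses

1. anti-symmetry `¬x_{ij} ∨ ¬x_{ji}`, 2. totality `x_{ij} ∨ x_{ji}` (`i ≠ j`),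
3. transitivity `¬x_{ij} ∨ ¬x_{jk} ∨ x_{ik}` (`i, j, k` distinct),
4. non-minimality `NM_i = ⋁_{j ≠ i} x_{ji}` (`i < n`).

`ORDER_n` (`linOrderClauses n`) is the set of clauses of types 1–3; an assignment is `ORDER_n`-PROPER
(`IsFProper (linOrderClauses n)`, `ResLinExtensible.lean`) iff it encodes a strict linear order on
`[n]` (`isFProper_linOrderClauses_iff`). This file is the dictionary between proper assignments and
RANKINGS `r : ℕ → ℕ` injective on `range n` (`OrderParitySystems.lean`): a proper `σ` is the
assignment of its own ranking `rankOf n σ` (number of elements below; `rankAssign_rankOf`), and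
every injective ranking gives a proper assignment (`isFProper_rankAssign`); `Ordering_n` is
unsatisfiable for `n ≥ 1` (`orderingCNF_not_satisfiable`: the minimum of the ranking falsifies its
non-minimality clause).

## References

* S. Gryaznov, S. Ovcharov, A. Riazanov, ACM Trans. Comput. Theory 16(3) (2024) = arXiv:2404.08370,
  §3.1.2 [GryaznovOvcharovRiazanov2024].
* S. Gryaznov, CSR 2019, LNCS 11532, §3.2 [Gryaznov2019].
-/

namespace Literature.Computability.MetaComplexity

open _root_.Computability Complexity Finset

/-! ### The clauses of `Ordering_n` -/

/-- The variable `x_{ij}` ("`i ≺ j`") of `Ordering_n`, numbered `i·n + j`.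
[Gryaznov–Ovcharov–Riazanov 2024, §3.1.2] [cite: GryaznovOvcharovRiazanov2024, §3.1.2] -/
def ordVar (n i j : ℕ) : ℕ :=
  i * n + j

/-- The ordered pairs `(i, j)` of distinct elements of `[n]`. [folklore] -/
def distinctPairs (n : ℕ) : List (ℕ × ℕ) :=
  (List.range n).flatMap fun i => ((List.range n).filter fun j => i ≠ j).map fun j => (i, j)

/-- The triples `(i, j, k)` of pairwise distinct elements of `[n]`. [folklore] -/
def distinctTriples (n : ℕ) : List (ℕ × ℕ × ℕ) :=
  (distinctPairs n).flatMap fun p =>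
    ((List.range n).filter fun k => p.1 ≠ k ∧ p.2 ≠ k).map fun k => (p.1, p.2, k)

/-- The list `ORDER_n` of clauses encoding a strict linear order: anti-symmetry `¬x_{ij} ∨ ¬x_{ji}`,
totality `x_{ij} ∨ x_{ji}` (`i ≠ j`) and transitivity `¬x_{ij} ∨ ¬x_{jk} ∨ x_{ik}` (`i, j, k`
distinct). [Gryaznov–Ovcharov–Riazanov 2024, §3.1.2 ("`ORDER_n` … types 1–3")]
[cite: GryaznovOvcharovRiazanov2024, §3.1.2] -/
def linOrderClauseList (n : ℕ) : List (Clause ℕ) :=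
  ((distinctPairs n).flatMap fun p =>
      [[(ordVar n p.1 p.2, false), (ordVar n p.2 p.1, false)],
        [(ordVar n p.1 p.2, true), (ordVar n p.2 p.1, true)]]) ++
    (distinctTriples n).map fun t =>
      [(ordVar n t.1 t.2.1, false), (ordVar n t.2.1 t.2.2, false), (ordVar n t.1 t.2.2, true)]

/-- The set `ORDER_n` of linear-order clauses (types 1–3), the "`F`" of extensibility.
[Gryaznov–Ovcharov–Riazanov 2024, §3.1.2] [cite: GryaznovOvcharovRiazanov2024, §3.1.2] -/
def linOrderClauses (n : ℕ) : Set (Clause ℕ) :=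
  {c | c ∈ linOrderClauseList n}

/-- The non-minimality clause `NM_i = ⋁_{j ≠ i} x_{ji}` ("`i` is not the minimum").
[Gryaznov–Ovcharov–Riazanov 2024, §3.1.2] [cite: GryaznovOvcharovRiazanov2024, §3.1.2] -/
def nonMinClause (n i : ℕ) : Clause ℕ :=
  ((List.range n).filter fun j => j ≠ i).map fun j => (ordVar n j i, true)

/-- **`Ordering_n`** [Gryaznov–Ovcharov–Riazanov 2024, §3.1.2]: the clauses of `ORDER_n` followed by
the non-minimality clauses `NM_0, …, NM_{n-1}`. [cite: GryaznovOvcharovRiazanov2024, §3.1.2] -/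
def orderingCNF (n : ℕ) : CNF ℕ :=
  linOrderClauseList n ++ (List.range n).map (nonMinClause n)

/-! ### Membership -/

/-- Membership in `distinctPairs`. [folklore] -/
theorem mem_distinctPairs {n : ℕ} {p : ℕ × ℕ} :
    p ∈ distinctPairs n ↔ p.1 < n ∧ p.2 < n ∧ p.1 ≠ p.2 := by
  obtain ⟨a, b⟩ := p
  simp only [distinctPairs, List.mem_flatMap, List.mem_map, List.mem_filter, List.mem_range,
    decide_eq_true_eq, Prod.mk.injEq]
  constructor
  · rintro ⟨i, hi, j, ⟨hj, hij⟩, rfl, rfl⟩; exact ⟨hi, hj, hij⟩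
  · rintro ⟨ha, hb, hab⟩; exact ⟨a, ha, b, ⟨hb, hab⟩, rfl, rfl⟩

/-- Membership in `distinctTriples`. [folklore] -/
theorem mem_distinctTriples {n : ℕ} {t : ℕ × ℕ × ℕ} :
    t ∈ distinctTriples n ↔
      t.1 < n ∧ t.2.1 < n ∧ t.2.2 < n ∧ t.1 ≠ t.2.1 ∧ t.1 ≠ t.2.2 ∧ t.2.1 ≠ t.2.2 := by
  obtain ⟨a, b, c⟩ := t
  simp only [distinctTriples, List.mem_flatMap, List.mem_map, List.mem_filter, List.mem_range,
    decide_eq_true_eq, Prod.mk.injEq, mem_distinctPairs]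
  constructor
  · rintro ⟨⟨i, j⟩, ⟨hi, hj, hij⟩, k, ⟨hk, hik, hjk⟩, rfl, rfl, rfl⟩
    exact ⟨hi, hj, hk, hij, hik, hjk⟩
  · rintro ⟨ha, hb, hc, hab, hac, hbc⟩
    exact ⟨(a, b), ⟨ha, hb, hab⟩, c, ⟨hc, hac, hbc⟩, rfl, rfl, rfl⟩

/-- The three shapes of a clause of `ORDER_n`. [Gryaznov–Ovcharov–Riazanov 2024, §3.1.2]
[cite: GryaznovOvcharovRiazanov2024, §3.1.2] -/
theorem mem_linOrderClauses_iff {n : ℕ} {c : Clause ℕ} :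
    c ∈ linOrderClauses n ↔
      (∃ i j, i < n ∧ j < n ∧ i ≠ j ∧
        (c = [(ordVar n i j, false), (ordVar n j i, false)] ∨
          c = [(ordVar n i j, true), (ordVar n j i, true)])) ∨
      ∃ i j k, i < n ∧ j < n ∧ k < n ∧ i ≠ j ∧ i ≠ k ∧ j ≠ k ∧
        c = [(ordVar n i j, false), (ordVar n j k, false), (ordVar n i k, true)] := by
  unfold linOrderClauses linOrderClauseList
  simp only [Set.mem_setOf_eq, List.mem_append, List.mem_flatMap, List.mem_map, List.mem_cons,
    List.not_mem_nil, or_false]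
  constructor
  · rintro (⟨⟨i, j⟩, hp, hc⟩ | ⟨⟨i, j, k⟩, ht, rfl⟩)
    · obtain ⟨hi, hj, hij⟩ := mem_distinctPairs.1 hp
      exact Or.inl ⟨i, j, hi, hj, hij, hc⟩
    · obtain ⟨hi, hj, hk, hij, hik, hjk⟩ := mem_distinctTriples.1 ht
      exact Or.inr ⟨i, j, k, hi, hj, hk, hij, hik, hjk, rfl⟩
  · rintro (⟨i, j, hi, hj, hij, hc⟩ | ⟨i, j, k, hi, hj, hk, hij, hik, hjk, rfl⟩)
    · exact Or.inl ⟨(i, j), mem_distinctPairs.2 ⟨hi, hj, hij⟩, hc⟩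
    · exact Or.inr ⟨(i, j, k), mem_distinctTriples.2 ⟨hi, hj, hk, hij, hik, hjk⟩, rfl⟩

/-- The clauses of `Ordering_n`: `ORDER_n` or a non-minimality clause.
[Gryaznov–Ovcharov–Riazanov 2024, §3.1.2] [cite: GryaznovOvcharovRiazanov2024, §3.1.2] -/
theorem mem_orderingCNF_iff {n : ℕ} {c : Clause ℕ} :
    c ∈ orderingCNF n ↔ c ∈ linOrderClauses n ∨ ∃ i < n, c = nonMinClause n i := by
  unfold orderingCNF linOrderClauses
  simp only [List.mem_append, List.mem_map, List.mem_range, Set.mem_setOf_eq]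
  constructor
  · rintro (h | ⟨i, hi, rfl⟩)
    · exact Or.inl h
    · exact Or.inr ⟨i, hi, rfl⟩
  · rintro (h | ⟨i, hi, rfl⟩)
    · exact Or.inl h
    · exact Or.inr ⟨i, hi, rfl⟩

/-- Non-minimality clauses are clauses of `Ordering_n`. [Gryaznov–Ovcharov–Riazanov 2024, §3.1.2]
[cite: GryaznovOvcharovRiazanov2024, §3.1.2] -/
theorem nonMinClause_mem_orderingCNF {n i : ℕ} (hi : i < n) : nonMinClause n i ∈ orderingCNF n :=
  mem_orderingCNF_iff.2 (Or.inr ⟨i, hi, rfl⟩)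

/-- `ORDER_n ⊆ Ordering_n`. [Gryaznov–Ovcharov–Riazanov 2024, §3.1.2] [cite: GryaznovOvcharovRiazanov2024, §3.1.2] -/
theorem mem_orderingCNF_of_mem_linOrderClauses {n : ℕ} {c : Clause ℕ} (hc : c ∈ linOrderClauses n) :
    c ∈ orderingCNF n :=
  mem_orderingCNF_iff.2 (Or.inl hc)

/-- A non-minimality clause is satisfied iff some `x_{ji}`, `j ≠ i`, is true. [Gryaznov–Ovcharov–
Riazanov 2024, §3.1.2] [cite: GryaznovOvcharovRiazanov2024, §3.1.2] -/
theorem eval_nonMinClause_iff {n i : ℕ} {σ : ℕ → Bool} :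
    Clause.eval σ (nonMinClause n i) = true ↔ ∃ j, j < n ∧ j ≠ i ∧ σ (ordVar n j i) = true := by
  simp only [Clause.eval, nonMinClause, List.any_eq_true, List.mem_map, List.mem_filter,
    List.mem_range, decide_eq_true_eq, Literal.eval, beq_iff_eq]
  constructor
  · rintro ⟨_, ⟨j, ⟨hj, hji⟩, rfl⟩, h⟩; exact ⟨j, hj, hji, h⟩
  · rintro ⟨j, hj, hji, h⟩; exact ⟨_, ⟨j, ⟨hj, hji⟩, rfl⟩, h⟩

/-! ### Proper assignments are linear orders -/

/-- **`ORDER_n`-proper solutions encode linear orders** [Gryaznov–Ovcharov–Riazanov 2024, Lemma 3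
(proof: "`ORDER_n`-proper solutions of `Ax = b` encode linear orders")]: properness unfolded into
anti-symmetry, totality and transitivity of the relation `x_{ij} = 1`.
[cite: GryaznovOvcharovRiazanov2024, Lemma 3] -/
theorem isFProper_linOrderClauses_iff {n : ℕ} {σ : ℕ → Bool} :
    IsFProper (linOrderClauses n) σ ↔
      (∀ i j, i < n → j < n → i ≠ j →
          ¬ (σ (ordVar n i j) = true ∧ σ (ordVar n j i) = true)) ∧
        (∀ i j, i < n → j < n → i ≠ j → σ (ordVar n i j) = true ∨ σ (ordVar n j i) = true) ∧
        ∀ i j k, i < n → j < n → k < n → i ≠ j → i ≠ k → j ≠ k →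
          σ (ordVar n i j) = true → σ (ordVar n j k) = true → σ (ordVar n i k) = true := by
  unfold IsFProper
  constructor
  · intro h
    refine ⟨fun i j hi hj hij => ?_, fun i j hi hj hij => ?_,
      fun i j k hi hj hk hij hik hjk h1 h2 => ?_⟩
    · have := h _ (mem_linOrderClauses_iff.2 (Or.inl ⟨i, j, hi, hj, hij, Or.inl rfl⟩))
      revert this
      cases h1 : σ (ordVar n i j) <;> cases h2 : σ (ordVar n j i) <;>
        simp [Clause.eval, Literal.eval, h1, h2]
    · have := h _ (mem_linOrderClauses_iff.2 (Or.inl ⟨i, j, hi, hj, hij, Or.inr rfl⟩))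
      revert this
      cases h1 : σ (ordVar n i j) <;> cases h2 : σ (ordVar n j i) <;>
        simp [Clause.eval, Literal.eval, h1, h2]
    · have := h _ (mem_linOrderClauses_iff.2 (Or.inr ⟨i, j, k, hi, hj, hk, hij, hik, hjk, rfl⟩))
      revert this
      cases h3 : σ (ordVar n i k) <;> simp [Clause.eval, Literal.eval, h1, h2, h3]
  · rintro ⟨hanti, htot, htrans⟩ c hc
    rcases mem_linOrderClauses_iff.1 hc with ⟨i, j, hi, hj, hij, rfl | rfl⟩ |
      ⟨i, j, k, hi, hj, hk, hij, hik, hjk, rfl⟩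
    · have := hanti i j hi hj hij
      revert this
      cases h1 : σ (ordVar n i j) <;> cases h2 : σ (ordVar n j i) <;>
        simp [Clause.eval, Literal.eval, h1, h2]
    · have := htot i j hi hj hij
      revert this
      cases h1 : σ (ordVar n i j) <;> cases h2 : σ (ordVar n j i) <;>
        simp [Clause.eval, Literal.eval, h1, h2]
    · have := htrans i j k hi hj hk hij hik hjk
      revert this
      cases h1 : σ (ordVar n i j) <;> cases h2 : σ (ordVar n j k) <;> cases h3 : σ (ordVar n i k) <;>
        simp [Clause.eval, Literal.eval, h1, h2, h3]

/-- The RANKING of an `ORDER_n`-proper assignment: the number of elements below `k`.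
[Gryaznov–Ovcharov–Riazanov 2024, Lemma 3 (proof: "`σ` … encodes the order `1 ≺ 2 ≺ ⋯ ≺ n`")]
[cite: GryaznovOvcharovRiazanov2024, Lemma 3] -/
def rankOf (n : ℕ) (σ : ℕ → Bool) (k : ℕ) : ℕ :=
  ((Finset.range n).filter fun l => l ≠ k ∧ σ (ordVar n l k) = true).card

/-- For a proper assignment, `x_{kl} = 1` iff `k` has fewer elements below it than `l`.
[Gryaznov–Ovcharov–Riazanov 2024, Lemma 3 (proof)] [cite: GryaznovOvcharovRiazanov2024, Lemma 3] -/
theorem eq_true_iff_rankOf_lt {n : ℕ} {σ : ℕ → Bool} (hσ : IsFProper (linOrderClauses n) σ)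
    {k l : ℕ} (hk : k < n) (hl : l < n) (hkl : k ≠ l) :
    σ (ordVar n k l) = true ↔ rankOf n σ k < rankOf n σ l := by
  obtain ⟨hanti, htot, htrans⟩ := isFProper_linOrderClauses_iff.1 hσ
  -- if `k ≺ l` then everything below `k` is below `l`, and `k` itself is below `l` only
  have key : ∀ {k l : ℕ}, k < n → l < n → k ≠ l → σ (ordVar n k l) = true →
      rankOf n σ k < rankOf n σ l := by
    intro k l hk hl hkl h
    unfold rankOf
    apply Finset.card_lt_card
    rw [Finset.ssubset_iff_of_subset]
    · refine ⟨k, ?_, ?_⟩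
      · rw [Finset.mem_filter, Finset.mem_range]; exact ⟨hk, hkl, h⟩
      · rw [Finset.mem_filter]; push Not; intro _ h'; exact absurd rfl h'
    · intro x hx
      rw [Finset.mem_filter, Finset.mem_range] at hx ⊢
      obtain ⟨hxn, hxk, hxσ⟩ := hx
      have hxl : x ≠ l := fun hx_eq => hanti k l hk hl hkl ⟨h, by rw [hx_eq] at hxσ; exact hxσ⟩
      exact ⟨hxn, hxl, htrans x k l hxn hk hl hxk hxl hkl hxσ h⟩
  constructor
  · exact key hk hl hkl
  · intro hlt
    rcases htot k l hk hl hkl with h | h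
    · exact h
    · exact absurd hlt (not_lt.2 (key hl hk (Ne.symm hkl) h).le)

/-- The ranking of a proper assignment is injective on `[n]`. [Gryaznov–Ovcharov–Riazanov 2024,
Lemma 3 (proof)] [cite: GryaznovOvcharovRiazanov2024, Lemma 3] -/
theorem injOn_rankOf {n : ℕ} {σ : ℕ → Bool} (hσ : IsFProper (linOrderClauses n) σ) :
    Set.InjOn (rankOf n σ) (Finset.range n : Finset ℕ) := by
  intro k hk l hl h
  rw [Finset.mem_coe, Finset.mem_range] at hk hl
  by_contra hkl
  obtain ⟨-, htot, -⟩ := isFProper_linOrderClauses_iff.1 hσ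
  rcases htot k l hk hl hkl with h' | h'
  · have := (eq_true_iff_rankOf_lt hσ hk hl hkl).1 h'; omega
  · have := (eq_true_iff_rankOf_lt hσ hl hk (Ne.symm hkl)).1 h'; omega

/-! ### Linear orders are proper assignments -/

/-- Quotient of a variable index: `(k·n + l) / n = k` for `l < n`. [folklore] -/
theorem ordVar_div {n k l : ℕ} (hl : l < n) : ordVar n k l / n = k := by
  unfold ordVar
  rw [Nat.add_comm, Nat.add_mul_div_right _ _ (by omega), Nat.div_eq_of_lt hl, zero_add]

/-- Residue of a variable index: `(k·n + l) % n = l` for `l < n`. [folklore] -/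
theorem ordVar_mod {n k l : ℕ} (hl : l < n) : ordVar n k l % n = l := by
  unfold ordVar
  rw [Nat.add_comm, Nat.add_mul_mod_self_right, Nat.mod_eq_of_lt hl]

/-- Variable indices are below `n²`. [folklore] -/
theorem ordVar_lt {n k l : ℕ} (hk : k < n) (hl : l < n) : ordVar n k l < n * n := by
  unfold ordVar
  calc k * n + l < k * n + n := by omega
    _ = (k + 1) * n := by ring
    _ ≤ n * n := Nat.mul_le_mul_right n hk

/-- The assignment of a RANKING `ρ`: `x_{kl} := [ρ k < ρ l]` on the variables of `Ordering_n`, and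
`σ` elsewhere (junk variables). [Gryaznov–Ovcharov–Riazanov 2024, Lemma 3 (proof: "their encodings
as `ORDER_n`-proper solutions")] [cite: GryaznovOvcharovRiazanov2024, Lemma 3] -/
def rankAssign (n : ℕ) (ρ : ℕ → ℕ) (σ : ℕ → Bool) : ℕ → Bool := fun v =>
  if v < n * n ∧ v / n ≠ v % n then decide (ρ (v / n) < ρ (v % n)) else σ v

/-- The assignment of a ranking on a variable `x_{kl}`. [folklore] -/
theorem rankAssign_ordVar {n : ℕ} (ρ : ℕ → ℕ) (σ : ℕ → Bool) {k l : ℕ} (hk : k < n) (hl : l < n)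
    (hkl : k ≠ l) : rankAssign n ρ σ (ordVar n k l) = decide (ρ k < ρ l) := by
  unfold rankAssign
  rw [ordVar_div hl, ordVar_mod hl, if_pos ⟨ordVar_lt hk hl, hkl⟩]

/-- **Linear orders are `ORDER_n`-proper**: the assignment of a ranking injective on `[n]` is proper.
[Gryaznov–Ovcharov–Riazanov 2024, Lemma 3 (proof)] [cite: GryaznovOvcharovRiazanov2024, Lemma 3] -/
theorem isFProper_rankAssign {n : ℕ} {ρ : ℕ → ℕ} (hρ : Set.InjOn ρ (Finset.range n : Finset ℕ))
    (σ : ℕ → Bool) : IsFProper (linOrderClauses n) (rankAssign n ρ σ) := by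
  have hne : ∀ {k l : ℕ}, k < n → l < n → k ≠ l → ρ k ≠ ρ l := fun hk hl hkl h =>
    hkl (hρ (by simpa using hk) (by simpa using hl) h)
  rw [isFProper_linOrderClauses_iff]
  refine ⟨fun i j hi hj hij => ?_, fun i j hi hj hij => ?_, fun i j k hi hj hk hij hik hjk => ?_⟩
  · rw [rankAssign_ordVar ρ σ hi hj hij, rankAssign_ordVar ρ σ hj hi (Ne.symm hij)]
    simp only [decide_eq_true_eq]; omega
  · rw [rankAssign_ordVar ρ σ hi hj hij, rankAssign_ordVar ρ σ hj hi (Ne.symm hij)]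
    simp only [decide_eq_true_eq]; have := hne hi hj hij; omega
  · rw [rankAssign_ordVar ρ σ hi hj hij, rankAssign_ordVar ρ σ hj hk hjk,
      rankAssign_ordVar ρ σ hi hk hik]
    simp only [decide_eq_true_eq]; omega

/-- A proper assignment IS the assignment of its own ranking. [Gryaznov–Ovcharov–Riazanov 2024,
Lemma 3 (proof)] [cite: GryaznovOvcharovRiazanov2024, Lemma 3] -/
theorem rankAssign_rankOf {n : ℕ} {σ : ℕ → Bool} (hσ : IsFProper (linOrderClauses n) σ) :
    rankAssign n (rankOf n σ) σ = σ := by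
  funext v
  unfold rankAssign
  split_ifs with h
  · obtain ⟨hv, hne⟩ := h
    have hn : 0 < n := Nat.pos_of_ne_zero fun h0 => by rw [h0] at hv; simp at hv
    have hk : v / n < n := Nat.div_lt_of_lt_mul hv
    have hl : v % n < n := Nat.mod_lt v hn
    have hv' : ordVar n (v / n) (v % n) = v := by unfold ordVar; exact Nat.div_add_mod' v n
    have := (eq_true_iff_rankOf_lt hσ hk hl hne)
    rw [hv'] at this
    revert this
    cases σ v <;> simp
  · rfl

/-- `ORDER_n`-proper assignments exist (the natural order). [Gryaznov–Ovcharov–Riazanov 2024, §3.1.2]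
[cite: GryaznovOvcharovRiazanov2024, §3.1.2] -/
theorem exists_isFProper_linOrderClauses (n : ℕ) : ∃ σ : ℕ → Bool, IsFProper (linOrderClauses n) σ :=
  ⟨rankAssign n id fun _ => false, isFProper_rankAssign (fun _ _ _ _ h => h) _⟩

/-- **`Ordering_n` is unsatisfiable** (`n ≥ 1`): a satisfying assignment is proper, hence a linear
order, whose minimum falsifies its non-minimality clause. [Gryaznov–Ovcharov–Riazanov 2024, §3.1.2
("an unsatisfiable CNF formula `Ordering_n`")] [cite: GryaznovOvcharovRiazanov2024, §3.1.2] -/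
theorem orderingCNF_not_satisfiable {n : ℕ} (hn : 1 ≤ n) : ¬ (orderingCNF n).Satisfiable := by
  rintro ⟨σ, hσ⟩
  rw [CNF.eval_eq_true_iff] at hσ
  have hprop : IsFProper (linOrderClauses n) σ := fun c hc =>
    hσ c (mem_orderingCNF_of_mem_linOrderClauses hc)
  obtain ⟨m, hm, hmin⟩ := Finset.exists_min_image (Finset.range n) (rankOf n σ)
    ⟨0, Finset.mem_range.2 (by omega)⟩
  rw [Finset.mem_range] at hm
  obtain ⟨j, hj, hjm, hσj⟩ := eval_nonMinClause_iff.1 (hσ _ (nonMinClause_mem_orderingCNF hm))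
  have hlt := (eq_true_iff_rankOf_lt hprop hj hm hjm).1 hσj
  exact absurd (hmin j (Finset.mem_range.2 hj)) (not_le.2 hlt)

/-- Every variable of `Ordering_n` is below `n²`. [folklore] -/
theorem fst_lt_of_mem_orderingCNF {n : ℕ} {c : Clause ℕ} (hc : c ∈ orderingCNF n) {l : Literal ℕ}
    (hl : l ∈ c) : l.1 < n * n := by
  rcases mem_orderingCNF_iff.1 hc with hc | ⟨i, hi, rfl⟩
  · rcases mem_linOrderClauses_iff.1 hc with ⟨i, j, hi, hj, -, rfl | rfl⟩ |
      ⟨i, j, k, hi, hj, hk, -, -, -, rfl⟩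
    · simp only [List.mem_cons, List.not_mem_nil, or_false] at hl
      rcases hl with rfl | rfl
      · exact ordVar_lt hi hj
      · exact ordVar_lt hj hi
    · simp only [List.mem_cons, List.not_mem_nil, or_false] at hl
      rcases hl with rfl | rfl
      · exact ordVar_lt hi hj
      · exact ordVar_lt hj hi
    · simp only [List.mem_cons, List.not_mem_nil, or_false] at hl
      rcases hl with rfl | rfl | rfl
      · exact ordVar_lt hi hj
      · exact ordVar_lt hj hk
      · exact ordVar_lt hi hk
  · simp only [nonMinClause, List.mem_map, List.mem_filter, List.mem_range, decide_eq_true_eq] at hl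
    obtain ⟨j, ⟨hj, -⟩, rfl⟩ := hl
    exact ordVar_lt hj hi

end Literature.Computability.MetaComplexity
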